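import Summits.CriticalPhenomena.Ising3DConformalLimit.Theorems.SubPtolemyInterlacingSubPtolemyFloorWallCostCertificate
import Summits.CriticalPhenomena.Ising3DConformalLimit.Theorems.SubPtolemyInterlacingSubPtolemyFloorCertificates
import Summits.CriticalPhenomena.Ising3DConformalLimit.Theorems.SubPtolemyFloor.Negative.ExponentCharacterisation
import Summits.CriticalPhenomena.Ising3DConformalLimit.Theorems.LeeYangGapGaussianLimitKillsBlockCouplingBlockSums
import HarnessLib

/-!
# `SubPtolemyFloor` (item stmt-CriticalPhenomena-15703): the round-1 transfer lines are the crux in costume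

Negative / structural knowledge about the crux
`Summit.CriticalPhenomena.Ising3DConformalLimit.Theses.SubPtolemyInterlacing.SubPtolemyFloor`
(route SubPtolemyInterlacing, r3: `∃ a c, a < log₂(1+√2) ∧ 0 < c ∧ ∀ n ≥ 1, c·n^{-a} ≤ ⟨σ₀σ_{n e₁}⟩⁺_{β_c(3)}`),
from the crux-triage panel (round 1, triager 1; evidence `Cruxes/SubPtolemyFloor/TRIAGE-r1-1.md`);
THEOREM-ONLY, no new definitions. Notation: `g(n) = ⟨σ₀σ_{n e₁}⟩_{β_c(3)}`, `χ_n = Σ_{x ∈ Λ_n} G(x)`,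
`B_n = Σ_{x,y ∈ Λ_n} G(y - x) = ⟨M_n²⟩`, `M_n = ⟨σ₀⟩⁺_{Λ_n;β_c,0}`, `L = log₂(1+√2) = 1.27155…`.

The three round-1 crux ideas (`plus-wall-quotient-ladder`, `volume-threshold-split`,
`lee-yang-tail-transfer`) transfer the crux into other currencies by dimension- and range-uniform
bookkeeping; their transfer lemmas are landed Theorems (`SubPtolemyFloorSketch.*`, `SubPtolemyFloorPlusWall.*`).
This file records, as theorems, that what is left in each currency is AT LEAST the crux:

* `boxSum_floor_of_axisFloor`, `susceptibilityFloor_of_crux` — the crux with exponent `a` already gives the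
  integrated floor `χ_n ≥ c' n^{3-a}` (MMS averaged sup-norm comparison); with the landed certificate
  `stub_cruxOfDoublingSusceptibilityFloor`: GIVEN axial doubling `κ > 1/8`,
  `SusceptibilityFloor(a₀ < L) ↔ crux` (`crux_iff_susceptibilityFloor_of_doubling`) — the transfer
  "Doubling ∧ SusceptibilityFloor" is the crux conjoined with an extra hypothesis.
* `blockSum_floor_of_axisFloor`, `blockPairFloor_of_crux`, `crux_iff_blockPairFloor_of_doubling` — the same in
  the block pair-sum currency `B_n ≥ c n^{6-2u}` (`u = a/2 < L/2`); the block-tail transfer asks the stronger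
  `u < 3L/(4+2L)` unconditionally.
* `approxSubmult_of_axisFloor`, `crux_iff_approxSubmult` — approximate submultiplicativity at the doubling
  scale with an exponent `0 ≤ p < L` is EQUIVALENT to the crux, unconditionally (`←` is the landed zero-mass
  Fekete ladder `subPtolemyFloor_of_approxSubmult`).
* `boxMag_le_rpow_of_wallCost`, `axisFloor_of_wallCost`, `wallCost_window`, `wallCost_consequences` — the
  engine `WallCost(q)`, `2q < L`, of the plus-wall line implies the crux AND a polynomially decaying upper
  bound `M_n ≤ K n^{q-1}`, `q - 1 < -1/4`, on the critical wired one-arm probability in `d = 3` (infrared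
  bound) — an open problem in print (van Engelenburg–Garban–Panis–Severo 2025, remark after Thm 1.12) — and
  an all-`n` axial floor with exponent `1 + q < 7/4` directly (Tasaki's `M_n ≥ c/n`).

References: M. Aizenman, H. Duminil-Copin, Ann. of Math. 194 (2021), §5.1–5.3 (MMS comparison in the sup
norm, averaged form); H. Duminil-Copin, *Lectures on the Ising and Potts models* (2019), Thm. 4.8 (infrared /
Simon–Lieb bounds); D. van Engelenburg, C. Garban, R. Panis, F. Severo, arXiv:2510.23423 (2025), Thm 1.1 and
the remark after Thm 1.12 (one-arm bounds in `d = 3`).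
-/

noncomputable section

namespace Summit.CriticalPhenomena.Ising3DConformalLimit.SubPtolemyFloorNegative

open scoped BigOperators Classical
open Finset Literature.Probability.LatticeModels
open Summit.CriticalPhenomena.Ising3DConformalLimit.Theses.SubPtolemyInterlacing
open Summit.CriticalPhenomena.Ising3DConformalLimit.LeeYangGapGaussianLimitKillsBlockCoupling

/-! ## §A The crux already delivers the integrated / pair-sum "hard factors" -/

/-- **crux(a, c) ⇒ χ_L ≥ c·2^{-a}·L^{3-a} for all L ≥ 1** (MMS averaged sup-norm comparison
`|Λ_{L/2}| g(2L) ≤ χ_{L/2} ≤ χ_L`, `|Λ_{L/2}| ≥ L³`). [cite: AizenmanDuminilCopinAnnals2021, arXiv:1912.07973 §5.3, display after the proof of Thm 5.6 (p. 19), first inequality] -/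
theorem boxSum_floor_of_axisFloor {a c : ℝ} (hc : 0 < c)
    (h : ∀ n : ℕ, 1 ≤ n →
      c * (n : ℝ) ^ (-a) ≤ criticalTwoPoint 3 ((n : ℤ) • (Pi.single 0 1 : Site 3))) :
    ∀ L : ℕ, 1 ≤ L →
      c * (2 : ℝ) ^ (-a) * (L : ℝ) ^ (3 - a) ≤ ∑ x ∈ box 3 L, criticalTwoPoint 3 x := by
  intro L hL
  have hL0 : (0 : ℝ) < L := by exact_mod_cast hL
  have h2L := h (2 * L) (by omega)
  rw [zsmul_single_zero_one] at h2L
  have hmms := card_mul_axis_le_boxSum L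
  have hmono := boxSum_mono (d := 3) (Nat.div_le_self L 2)
  have hcard := pow_three_le_card_box_half L
  have e1 : (L : ℝ) ^ (3 - a) = (L : ℝ) ^ 3 * (L : ℝ) ^ (-a) := by
    rw [sub_eq_add_neg, Real.rpow_add hL0, ← Real.rpow_natCast]
    norm_num
  calc c * (2 : ℝ) ^ (-a) * (L : ℝ) ^ (3 - a)
      = (L : ℝ) ^ 3 * (c * ((2 * L : ℕ) : ℝ) ^ (-a)) := by
        rw [e1]; push_cast; rw [Real.mul_rpow (by norm_num) hL0.le]; ring
    _ ≤ (#(box 3 (L / 2)) : ℝ) * criticalTwoPoint 3 (Pi.single 0 ((2 * L : ℕ) : ℤ)) :=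
        mul_le_mul hcard h2L (by positivity) (Nat.cast_nonneg _)
    _ ≤ ∑ x ∈ box 3 (L / 2), criticalTwoPoint 3 x := hmms
    _ ≤ ∑ x ∈ box 3 L, criticalTwoPoint 3 x := hmono

/-- **crux(a, c) ⇒ B_L = Σ_{x,y ∈ Λ_L} G(y - x) ≥ c·2^{-a}·L^{6-a} for all L ≥ 1**
(`|Λ_{L/2}|² g(2L) ≤ B_L`). In the block-tail card's currency: the pair-sum floor with `u = a/2`. [cite: AizenmanDuminilCopinAnnals2021, arXiv:1912.07973 §5.3, display after the proof of Thm 5.6 (p. 19), first inequality] -/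
theorem blockSum_floor_of_axisFloor {a c : ℝ} (hc : 0 < c)
    (h : ∀ n : ℕ, 1 ≤ n →
      c * (n : ℝ) ^ (-a) ≤ criticalTwoPoint 3 ((n : ℤ) • (Pi.single 0 1 : Site 3))) :
    ∀ L : ℕ, 1 ≤ L →
      c * (2 : ℝ) ^ (-a) * (L : ℝ) ^ (6 - a) ≤
        ∑ x ∈ box 3 L, ∑ y ∈ box 3 L, criticalTwoPoint 3 (y - x) := by
  intro L hL
  have hL0 : (0 : ℝ) < L := by exact_mod_cast hL
  have h2L := h (2 * L) (by omega)
  rw [zsmul_single_zero_one] at h2L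
  have hmms := card_sq_mul_axis_le_blockSum L
  simp only [criticalCorr_two_pair] at hmms
  have hcard := pow_three_le_card_box_half L
  have hcard2 : (L : ℝ) ^ 6 ≤ (#(box 3 (L / 2)) : ℝ) ^ 2 := by
    calc (L : ℝ) ^ 6 = ((L : ℝ) ^ 3) ^ 2 := by ring
      _ ≤ (#(box 3 (L / 2)) : ℝ) ^ 2 := pow_le_pow_left₀ (by positivity) hcard 2
  have e1 : (L : ℝ) ^ (6 - a) = (L : ℝ) ^ 6 * (L : ℝ) ^ (-a) := by
    rw [sub_eq_add_neg, Real.rpow_add hL0, ← Real.rpow_natCast]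
    norm_num
  calc c * (2 : ℝ) ^ (-a) * (L : ℝ) ^ (6 - a)
      = (L : ℝ) ^ 6 * (c * ((2 * L : ℕ) : ℝ) ^ (-a)) := by
        rw [e1]; push_cast; rw [Real.mul_rpow (by norm_num) hL0.le]; ring
    _ ≤ (#(box 3 (L / 2)) : ℝ) ^ 2 * criticalTwoPoint 3 (Pi.single 0 ((2 * L : ℕ) : ℤ)) :=
        mul_le_mul hcard2 h2L (by positivity) (by positivity)
    _ ≤ ∑ x ∈ box 3 L, ∑ y ∈ box 3 L, criticalTwoPoint 3 (y - x) := hmms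

/-- **The crux implies the integrated floor `SusceptibilityFloor(a₀)` with `1 ≤ a₀ < L`** (the
"hard factor" of card volume-threshold-split). [folklore] -/
theorem susceptibilityFloor_of_crux (h : SubPtolemyFloor) :
    ∃ a₀ : ℝ, 1 ≤ a₀ ∧ a₀ < Real.logb 2 (1 + Real.sqrt 2) ∧
      ∃ c : ℝ, 0 < c ∧ ∀ n : ℕ, 1 ≤ n →
        c * (n : ℝ) ^ (3 - a₀) ≤ ∑ x ∈ box 3 n, criticalTwoPoint 3 x := by
  obtain ⟨a, c, ha, hc, h⟩ := h
  exact ⟨a, SubPtolemyFloorNegative.exponent_ge_one hc h, ha, c * (2 : ℝ) ^ (-a), by positivity,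
    boxSum_floor_of_axisFloor hc h⟩

/-- **The crux implies the pair-sum floor `B_n ≥ c n^{6-2u}` with `1/2 ≤ u < L/2 ≈ 0.6358`** (the
currency of card lee-yang-tail-transfer; its transfer asks `u < 0.5830`, its doubling-assisted form
`u < 0.6358`). [folklore] -/
theorem blockPairFloor_of_crux (h : SubPtolemyFloor) :
    ∃ u : ℝ, 1 / 2 ≤ u ∧ 2 * u < Real.logb 2 (1 + Real.sqrt 2) ∧
      ∃ c : ℝ, 0 < c ∧ ∀ n : ℕ, 1 ≤ n →
        c * (n : ℝ) ^ (6 - 2 * u) ≤ ∑ x ∈ box 3 n, ∑ y ∈ box 3 n, criticalTwoPoint 3 (y - x) := by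
  obtain ⟨a, c, ha, hc, h⟩ := h
  have h1 := SubPtolemyFloorNegative.exponent_ge_one hc h
  refine ⟨a / 2, by linarith, by linarith, c * (2 : ℝ) ^ (-a), by positivity, fun n hn => ?_⟩
  have e : (6 - 2 * (a / 2) : ℝ) = 6 - a := by ring
  rw [e]
  exact blockSum_floor_of_axisFloor hc h n hn

/-- **COSTUME (volume-threshold-split).** Given the card's soft factor — axial doubling with a constant
`κ > 1/8` — its hard factor `SusceptibilityFloor(a₀ < L)` is EQUIVALENT to the crux
(`←`: landed certificate C2 `stub_cruxOfDoublingSusceptibilityFloor`, p129874; `→`: the crux alone). [folklore] -/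
theorem crux_iff_susceptibilityFloor_of_doubling {κ : ℝ} (hκ : 1 / 8 < κ)
    (hd : ∀ n : ℕ, 1 ≤ n →
      κ * criticalTwoPoint 3 ((n : ℤ) • (Pi.single 0 1 : Site 3)) ≤
        criticalTwoPoint 3 (((2 * n : ℕ) : ℤ) • (Pi.single 0 1 : Site 3))) :
    SubPtolemyFloor ↔
      ∃ a₀ : ℝ, a₀ < Real.logb 2 (1 + Real.sqrt 2) ∧
        ∃ c : ℝ, 0 < c ∧ ∀ n : ℕ, 1 ≤ n →
          c * (n : ℝ) ^ (3 - a₀) ≤ ∑ x ∈ box 3 n, criticalTwoPoint 3 x := by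
  constructor
  · intro h
    obtain ⟨a₀, -, ha, hs⟩ := susceptibilityFloor_of_crux h
    exact ⟨a₀, ha, hs⟩
  · rintro ⟨a₀, ha, c, hc, hs⟩
    exact SubPtolemyFloorSketch.stub_cruxOfDoublingSusceptibilityFloor ⟨κ, a₀, hκ, ha, hd, c, hc, hs⟩

/-- **COSTUME (lee-yang-tail-transfer, doubling-assisted form).** Given axial doubling `κ > 1/8`, the
pair-sum floor `B_n ≥ c n^{6-2u}` for some `u` with `2u < L` (and `2u ≤ 3`, automatic for such `u`)
is EQUIVALENT to the crux (`←`: landed S3 `stub_susceptibilityFloorOfBoxPairFloor`, p129162, then C2;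
`→`: `blockPairFloor_of_crux`). The card's unconditional transfer asks the STRONGER `u < 3L/(4+2L)`. [folklore] -/
theorem crux_iff_blockPairFloor_of_doubling {κ : ℝ} (hκ : 1 / 8 < κ)
    (hd : ∀ n : ℕ, 1 ≤ n →
      κ * criticalTwoPoint 3 ((n : ℤ) • (Pi.single 0 1 : Site 3)) ≤
        criticalTwoPoint 3 (((2 * n : ℕ) : ℤ) • (Pi.single 0 1 : Site 3))) :
    SubPtolemyFloor ↔
      ∃ u : ℝ, 2 * u ≤ 3 ∧ 2 * u < Real.logb 2 (1 + Real.sqrt 2) ∧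
        ∃ c : ℝ, 0 < c ∧ ∀ n : ℕ, 1 ≤ n →
          c * (n : ℝ) ^ (6 - 2 * u) ≤ ∑ x ∈ box 3 n, ∑ y ∈ box 3 n, criticalTwoPoint 3 (y - x) := by
  constructor
  · intro h
    obtain ⟨u, -, hu, hB⟩ := blockPairFloor_of_crux h
    exact ⟨u, by linarith [SubPtolemyFloorNegative.threshold_lt_two], hu, hB⟩
  · rintro ⟨u, hu3, hu, hB⟩
    have hS := SubPtolemyFloorSketch.stub_susceptibilityFloorOfBoxPairFloor (6 - 2 * u) (by linarith) hB
    have e : (3 - (6 - (6 - 2 * u)) : ℝ) = 3 - 2 * u := by ring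
    rw [e] at hS
    exact SubPtolemyFloorSketch.stub_cruxOfDoublingSusceptibilityFloor ⟨κ, 2 * u, hκ, hu, hd, hS⟩

/-! ## §B plus-wall-quotient-ladder: the architecture certificate IS the crux; the engine is more -/

/-- **crux(a, c) ⇒ ApproxSubmult(p = a, C = c⁻¹)**: `g(2n+2) ≤ g(n) = g(n)²/g(n) ≤ c⁻¹ n^a g(n)²`
(axial monotonicity, Messager–Miracle-Solé). [cite: MessagerMiracleSoleJSP1977, main theorem (monotonicity of ⟨σ₀σ_x⟩ under reflections)] -/
theorem approxSubmult_of_axisFloor {a c : ℝ} (hc : 0 < c)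
    (h : ∀ n : ℕ, 1 ≤ n →
      c * (n : ℝ) ^ (-a) ≤ criticalTwoPoint 3 ((n : ℤ) • (Pi.single 0 1 : Site 3))) :
    ∀ n : ℕ, 1 ≤ n →
      criticalTwoPoint 3 (((2 * n + 2 : ℕ) : ℤ) • (Pi.single 0 1 : Site 3)) ≤
        c⁻¹ * (n : ℝ) ^ a * criticalTwoPoint 3 ((n : ℤ) • (Pi.single 0 1 : Site 3)) ^ 2 := by
  intro n hn
  have hn0 : (0 : ℝ) < n := by exact_mod_cast hn
  have hgn := h n hn
  rw [zsmul_single_zero_one] at hgn ⊢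
  rw [zsmul_single_zero_one]
  have hg0 : 0 ≤ criticalTwoPoint 3 (Pi.single 0 (n : ℤ)) := criticalTwoPoint_nonneg' _
  have hanti : criticalTwoPoint 3 (Pi.single 0 ((2 * n + 2 : ℕ) : ℤ)) ≤
      criticalTwoPoint 3 (Pi.single 0 (n : ℤ)) :=
    criticalTwoPoint_axis_antitone (show n ≤ 2 * n + 2 by omega)
  have hna : (n : ℝ) ^ a ≠ 0 := (Real.rpow_pos_of_pos hn0 a).ne'
  have hone : c⁻¹ * (n : ℝ) ^ a * (c * (n : ℝ) ^ (-a)) = 1 := by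
    rw [Real.rpow_neg hn0.le]
    field_simp
  calc criticalTwoPoint 3 (Pi.single 0 ((2 * n + 2 : ℕ) : ℤ))
      ≤ criticalTwoPoint 3 (Pi.single 0 (n : ℤ)) := hanti
    _ = c⁻¹ * (n : ℝ) ^ a * (c * (n : ℝ) ^ (-a)) * criticalTwoPoint 3 (Pi.single 0 (n : ℤ)) := by
        rw [hone, one_mul]
    _ ≤ c⁻¹ * (n : ℝ) ^ a * criticalTwoPoint 3 (Pi.single 0 (n : ℤ)) *
          criticalTwoPoint 3 (Pi.single 0 (n : ℤ)) :=
        mul_le_mul_of_nonneg_right (mul_le_mul_of_nonneg_left hgn (by positivity)) hg0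
    _ = c⁻¹ * (n : ℝ) ^ a * criticalTwoPoint 3 (Pi.single 0 (n : ℤ)) ^ 2 := by ring

/-- **COSTUME (plus-wall-quotient-ladder, lever (i)).** The card's architecture certificate —
approximate submultiplicativity at the doubling scale with some exponent `0 ≤ p < L` — is EQUIVALENT
to the crux, unconditionally (`←`: landed `subPtolemyFloor_of_approxSubmult`, p131160 = zero-mass
Fekete ladder + Simon–Lieb; `→`: `approxSubmult_of_axisFloor` + the IR window `1 ≤ a`). The ladder
relocates the crux; it removes nothing from it. [folklore] -/
theorem crux_iff_approxSubmult :
    SubPtolemyFloor ↔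
      ∃ p C : ℝ, 0 ≤ p ∧ p < Real.logb 2 (1 + Real.sqrt 2) ∧ 0 < C ∧ ∀ n : ℕ, 1 ≤ n →
        criticalTwoPoint 3 (((2 * n + 2 : ℕ) : ℤ) • (Pi.single 0 1 : Site 3)) ≤
          C * (n : ℝ) ^ p * criticalTwoPoint 3 ((n : ℤ) • (Pi.single 0 1 : Site 3)) ^ 2 := by
  constructor
  · rintro ⟨a, c, ha, hc, h⟩
    exact ⟨a, c⁻¹, zero_le_one.trans (SubPtolemyFloorNegative.exponent_ge_one hc h), ha,
      inv_pos.2 hc, approxSubmult_of_axisFloor hc h⟩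
  · rintro ⟨p, C, hp0, hp, hC, h⟩
    exact SubPtolemyFloorPlusWall.subPtolemyFloor_of_approxSubmult hp0 hp hC h

/-- **WallCost(q) ⇒ a polynomially decaying UPPER bound on the critical wired one-arm probability in
`d = 3`**: `M_n = ⟨σ₀⟩⁺_{Λ_n;β_c} = φ¹_{Λ_n,β_c}[0 ↔ ∂Λ_n] ≤ K n^{q-1}` (infrared bound `g(n) ≤ K/n`).
For the card's window `2q < L` one has `q - 1 < -1/4` (`wallCost_window`): such a bound is stated OPEN
in van Engelenburg–Garban–Panis–Severo 2025 (remark after Thm 1.12). [cite: DuminilCopin2019, Thm. 4.8, §4.4 (infrared bound)] [cite: VanEngelenburgGarbanPanisSevero2025, remark after Thm. 1.12 (polynomial upper bound on the one-arm probability in d = 3 open)] -/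
theorem boxMag_le_rpow_of_wallCost {q C : ℝ} (hC : 0 < C)
    (hW : ∀ n : ℕ, 1 ≤ n →
      isingCorr (zdGraph 3) (box 3 n) (criticalBeta 3) 0 BoundaryCondition.plus {0} ≤
        C * (n : ℝ) ^ q * criticalTwoPoint 3 ((n : ℤ) • (Pi.single 0 1 : Site 3))) :
    ∃ K : ℝ, 0 < K ∧ ∀ n : ℕ, 1 ≤ n →
      isingCorr (zdGraph 3) (box 3 n) (criticalBeta 3) 0 BoundaryCondition.plus {0} ≤
        K * (n : ℝ) ^ (q - 1) := by
  obtain ⟨K, hK0, hK⟩ := exists_criticalTwoPoint_le_inv_pow (d := 3) le_rfl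
  refine ⟨C * (K + 1), by positivity, fun n hn => ?_⟩
  have hn0 : (0 : ℝ) < n := by exact_mod_cast hn
  have hIR := hK _ (SubPtolemyFloorNegative.axis_ne_zero hn)
  rw [SubPtolemyFloorNegative.supNorm_axis] at hIR
  have hIR' : criticalTwoPoint 3 ((n : ℤ) • (Pi.single 0 1 : Site 3)) ≤ (K + 1) * (n : ℝ)⁻¹ := by
    refine hIR.trans ?_
    norm_num
    exact mul_le_mul_of_nonneg_right (by linarith) (inv_nonneg.2 hn0.le)
  calc isingCorr (zdGraph 3) (box 3 n) (criticalBeta 3) 0 BoundaryCondition.plus {0}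
      ≤ C * (n : ℝ) ^ q * criticalTwoPoint 3 ((n : ℤ) • (Pi.single 0 1 : Site 3)) := hW n hn
    _ ≤ C * (n : ℝ) ^ q * ((K + 1) * (n : ℝ)⁻¹) :=
        mul_le_mul_of_nonneg_left hIR' (by positivity)
    _ = C * (K + 1) * (n : ℝ) ^ (q - 1) := by
        rw [Real.rpow_sub_one hn0.ne']; ring

/-- **WallCost(q) ⇒ an all-`n` axial floor with exponent `1 + q` directly** (Tasaki's one-arm lower
bound `M_n ≥ c/n`, landed `boxMag_ge_inv`, p131160): `g(n) ≥ (c/C) n^{-(1+q)}`. For `2q < L`,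
`1 + q < 7/4 < 2` (`wallCost_window`), below the rigorous all-`n` frontier `2` (Simon–Lieb). [cite: VanEngelenburgGarbanPanisSevero2025, Thm. 1.1 and the paragraph after it (Tasaki's argument in d = 3)] -/
theorem axisFloor_of_wallCost {q C : ℝ} (hC : 0 < C)
    (hW : ∀ n : ℕ, 1 ≤ n →
      isingCorr (zdGraph 3) (box 3 n) (criticalBeta 3) 0 BoundaryCondition.plus {0} ≤
        C * (n : ℝ) ^ q * criticalTwoPoint 3 ((n : ℤ) • (Pi.single 0 1 : Site 3))) :
    ∃ c : ℝ, 0 < c ∧ ∀ n : ℕ, 1 ≤ n →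
      c * (n : ℝ) ^ (-(1 + q)) ≤ criticalTwoPoint 3 ((n : ℤ) • (Pi.single 0 1 : Site 3)) := by
  obtain ⟨c, hc, hcM⟩ := SubPtolemyFloorPlusWall.boxMag_ge_inv
  refine ⟨c / C, by positivity, fun n hn => ?_⟩
  have hn0 : (0 : ℝ) < n := by exact_mod_cast hn
  have hq0 : 0 < (n : ℝ) ^ q := Real.rpow_pos_of_pos hn0 q
  have h1 : c * (n : ℝ)⁻¹ ≤
      C * (n : ℝ) ^ q * criticalTwoPoint 3 ((n : ℤ) • (Pi.single 0 1 : Site 3)) :=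
    (hcM n hn).trans (hW n hn)
  have e : (n : ℝ) ^ (-(1 + q)) = (n : ℝ)⁻¹ * ((n : ℝ) ^ q)⁻¹ := by
    rw [Real.rpow_neg hn0.le, Real.rpow_add hn0, Real.rpow_one, mul_inv]
  have e2 : c / C * ((n : ℝ)⁻¹ * ((n : ℝ) ^ q)⁻¹) = c * (n : ℝ)⁻¹ / (C * (n : ℝ) ^ q) := by
    ring
  rw [e, e2, div_le_iff₀ (by positivity)]
  calc c * (n : ℝ)⁻¹
      ≤ C * (n : ℝ) ^ q * criticalTwoPoint 3 ((n : ℤ) • (Pi.single 0 1 : Site 3)) := h1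
    _ = criticalTwoPoint 3 ((n : ℤ) • (Pi.single 0 1 : Site 3)) * (C * (n : ℝ) ^ q) := by ring

/-- **The engine's window in numbers**: for `2q < L = log₂(1+√2)` (`< 3/2`), the one-arm exponent of
`boxMag_le_rpow_of_wallCost` is `q - 1 < -1/4 < 0` and the floor exponent of `axisFloor_of_wallCost` is
`1 + q < 7/4 < 2`; and `wallCost_false_of_lt_half` (p131160) forces `1/2 ≤ q`. [folklore] -/
theorem wallCost_window {q : ℝ} (hq : 2 * q < Real.logb 2 (1 + Real.sqrt 2)) :
    q - 1 < -(1 / 4) ∧ 1 + q < 7 / 4 := by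
  have h := SubPtolemyFloorNegative.threshold_lt_three_halves
  constructor <;> linarith

/-- **COSTUME + HARDER (plus-wall-quotient-ladder, the engine).** `WallCost(q)`, `2q < L`, implies the
crux (landed `stub_cruxOfWallCost`, p131160) AND the open one-arm decay bound; nothing flows back
(the crux gives `M_n ≤ 1 ≤ c⁻¹ n^a g(n)` only, i.e. `WallCost(a)` with `2a ≥ 2 > L`). [cite: VanEngelenburgGarbanPanisSevero2025, remark after Thm. 1.12 (polynomial upper bound on the one-arm probability in d = 3 open)] -/
theorem wallCost_consequences {q C : ℝ} (hq : 2 * q < Real.logb 2 (1 + Real.sqrt 2)) (hC : 0 < C)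
    (hW : ∀ n : ℕ, 1 ≤ n →
      isingCorr (zdGraph 3) (box 3 n) (criticalBeta 3) 0 BoundaryCondition.plus {0} ≤
        C * (n : ℝ) ^ q * criticalTwoPoint 3 ((n : ℤ) • (Pi.single 0 1 : Site 3))) :
    SubPtolemyFloor ∧
      (∃ K s : ℝ, 0 < K ∧ s < -(1 / 4) ∧ ∀ n : ℕ, 1 ≤ n →
        isingCorr (zdGraph 3) (box 3 n) (criticalBeta 3) 0 BoundaryCondition.plus {0} ≤
          K * (n : ℝ) ^ s) := by
  refine ⟨SubPtolemyFloorPlusWall.stub_cruxOfWallCost ⟨q, C, hq, hC, hW⟩, ?_⟩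
  obtain ⟨K, hK, h⟩ := boxMag_le_rpow_of_wallCost hC hW
  exact ⟨K, q - 1, hK, (wallCost_window hq).1, h⟩

end Summit.CriticalPhenomena.Ising3DConformalLimit.SubPtolemyFloorNegative

end
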